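import Mathlib
import Summits.Ventures.PercRepro2.HCov
import Summits.Ventures.PercRepro2.BHKAvoid
import Summits.Ventures.PercRepro2.ExploreA3
import Summits.Ventures.PercRepro2.RootLeafUSW2

/-!
# (SW2) for every increasing cluster event (blind cell PercRepro2, p4 g9; proofs/P4-G9-SW2.md §8)

The theorem `RootLeafU.SW2.sw2` (RootLeafUSW2.lean) is the case `𝓥 = {W | o ∈ W}` of
**(SW2-𝓥)** `P(a₂ ↮ c, a₂ ↔ u) · P(PD, K ∈ 𝓥) ≤ P(PD) · P(a₂ ↮ c, a₂ ↔ u, K ∈ 𝓥)` for every UP-SET `𝓥`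
of vertex sets (`K = C(a₂)`, `PD = {u ↮ a₂, u ↮ c, a₂ ↮ c}`): conditioning the cluster of `a₂` on
`{a₂ ↔ u, a₂ ↮ c}` makes every increasing event of the cluster at least as likely as conditioning on
the three-way separation `PD` — e.g. `𝓥 = {W | x ∈ W ∧ y ∈ W}` (the pair domination of
P4-G8-SEP.md §10(b)) or `𝓥 = {W | k ≤ |W|}`.  Same proof (`sw2_core_upset`, `sw2_upset`): explore
`C(c)` with the avoided set `{u, a₂}`, Harris in `G ∖ C(c)`, BHK06 Thm 1.3 (functional, avoided set) for
the antitone residuals `g_u` and `g_𝓥`.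
-/

namespace Summit.Ventures.PercRepro2

open UnionCluster CovForm

namespace RootLeafU

namespace SW2

section Upset

variable {V : Type*} {E : Type*} [Fintype E] [DecidableEq E] [Fintype V] [DecidableEq V]
  {R : Type*} [CommRing R] [LinearOrder R] [IsStrictOrderedRing R]

variable (p : E → R) (ends : E → Sym2 V) (a₂ c u : V)

omit [Fintype E] [DecidableEq E] [Fintype V] in
/-- `{a₂ ↔ u} ∩ {K ∈ 𝓥} ∩ {c ↮ u, c ↮ a₂} = {a₂ ↮ c} ∩ ({a₂ ↔ u} ∩ {K ∈ 𝓥})`. -/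
lemma connEvent_inter_clusterIn_inter_avoid_eq (𝓥 : Set (Set V)) :
    connEvent ends a₂ u ∩ clusterInEvent ends a₂ 𝓥 ∩ avoidAll ends c {u, a₂} =
      avoidAll ends a₂ {c} ∩ (connEvent ends a₂ u ∩ clusterInEvent ends a₂ 𝓥) := by
  rw [Set.inter_assoc, Set.inter_comm (clusterInEvent ends a₂ 𝓥), ← Set.inter_assoc,
    connEvent_inter_avoid_eq, Set.inter_assoc]

/-- **(SW2′) for an increasing cluster event**: for every up-set `𝓥` of vertex sets,
`P(a₂ ↮ c, a₂ ↔ u) · P(c ↮ u, c ↮ a₂, K ∈ 𝓥) ≤ P(c ↮ u, c ↮ a₂) · P(a₂ ↮ c, a₂ ↔ u, K ∈ 𝓥)` (`K = C(a₂)`)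
— the proof of `SW2.sw2_core` with `{W | o ∈ W}` replaced by `𝓥`: explore `C(c)` with the avoided set
`{u, a₂}`, Harris in `G ∖ C(c)`, BHK06 Thm 1.3 for the antitone residuals `g_u`, `g_𝓥`. -/
theorem sw2_core_upset (hp : IsProbVec p) {𝓥 : Set (Set V)} (h𝓥 : IsUpperSet 𝓥) :
    prob p (avoidAll ends a₂ {c} ∩ connEvent ends a₂ u) *
        prob p (avoidAll ends c {u, a₂} ∩ clusterInEvent ends a₂ 𝓥) ≤
      prob p (avoidAll ends c {u, a₂}) *
        prob p (avoidAll ends a₂ {c} ∩ (connEvent ends a₂ u ∩ clusterInEvent ends a₂ 𝓥)) := by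
  classical
  have ha : a₂ ∈ ({u, a₂} : Finset V) := by simp
  -- the residual functionals of the cluster of `c`
  set gu := delClusterProb p ends a₂ {W | u ∈ W} with hgu
  set go := delClusterProb p ends a₂ 𝓥 with hgo
  set guo := delClusterProb p ends a₂ ({W | u ∈ W} ∩ 𝓥) with hguo
  -- exploration identities
  have hcU : clusterInEvent ends c Set.univ = Set.univ := by
    ext ω; simp [clusterInEvent]
  have hcUO : clusterInEvent ends a₂ ({W | u ∈ W} ∩ 𝓥) =
      connEvent ends a₂ u ∩ clusterInEvent ends a₂ 𝓥 := rfl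
  have eU := prob_clusterIn_inter_avoid_eq_expect p ends c a₂ ha Set.univ {W | u ∈ W}
  have eO := prob_clusterIn_inter_avoid_eq_expect p ends c a₂ ha Set.univ 𝓥
  have eUO := prob_clusterIn_inter_avoid_eq_expect p ends c a₂ ha Set.univ
    ({W | u ∈ W} ∩ 𝓥)
  simp only [Set.indicator_univ, Pi.one_apply, one_mul] at eU eO eUO
  rw [hcU, Set.univ_inter, ExploreA3.clusterInEvent_mem_eq, connEvent_inter_avoid_eq] at eU
  rw [hcU, Set.univ_inter] at eO
  rw [hcU, Set.univ_inter, hcUO, connEvent_inter_clusterIn_inter_avoid_eq] at eUO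
  have eR : prob p (avoidAll ends c {u, a₂}) =
      expect p fun ω => (avoidAll ends c {u, a₂}).indicator 1 ω := prob_eq_expect_indicator p _
  -- Harris in `G ∖ W`, pointwise in the explored cluster
  have hpt : ∀ W : Set V, gu W * go W ≤ guo W := by
    intro W
    simp only [hgu, hgo, hguo, delClusterProb]
    have hmono : ∀ 𝓥 : Set (Set V), IsUpperSet 𝓥 →
        IsUpperSet {ω : Config E | cluster ends (delConfig ends W ω) a₂ ∈ 𝓥} := by
      intro 𝓥 h𝓥 ω ω' hle hω
      exact h𝓥 (cluster_mono (ExploreA3.delConfig_mono ends W hle) a₂) hω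
    have h := prob_mul_prob_le_prob_inter hp (hmono {W | u ∈ W} (fun _ _ h hW => h hW))
      (hmono 𝓥 h𝓥)
    refine h.trans (le_of_eq ?_)
    congr 1
  -- the functional BHK06 Thm 1.3 with the avoided set `{u, a₂}`
  have hgu_anti : Antitone gu := delClusterProb_anti p hp ends a₂ (fun _ _ h hW => h hW)
  have hgo_anti : Antitone go := delClusterProb_anti p hp ends a₂ h𝓥
  have hgu1 : ∀ W, gu W ≤ 1 := delClusterProb_le_one p hp ends a₂ _
  have hgo1 : ∀ W, go W ≤ 1 := delClusterProb_le_one p hp ends a₂ _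
  have hF₁ : Monotone (fun W => 1 - gu W) := fun W W' h => by
    simp only
    linarith [hgu_anti h]
  have hF₂ : Monotone (fun W => 1 - go W) := fun W W' h => by
    simp only
    linarith [hgo_anti h]
  have hF₁0 : ∀ W, 0 ≤ 1 - gu W := fun W => by linarith [hgu1 W]
  have hF₂0 : ∀ W, 0 ≤ 1 - go W := fun W => by linarith [hgo1 W]
  have key := bhk_induced p hp ends c hF₁ hF₂ hF₁0 hF₂0 Finset.univ {u, a₂} {u, a₂}
    (Finset.subset_univ _) (Finset.subset_univ _)
  simp only [Finset.inter_self, Finset.union_self, REvent_univ] at key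
  have e : ∀ F : Set V → R, clusterObs ends Finset.univ c F *
      (avoidAll ends c {u, a₂}).indicator 1 =
      fun ω => F (cluster ends ω c) * (avoidAll ends c {u, a₂}).indicator 1 ω := by
    intro F
    funext ω
    simp only [Pi.mul_apply, clusterObs_apply, clusterIn_univ]
  rw [e, e, e] at key
  simp only [Pi.mul_apply] at key
  -- the three expectations
  have e1 : expect p (fun ω => (1 - gu (cluster ends ω c)) *
      (avoidAll ends c {u, a₂}).indicator 1 ω) =
      prob p (avoidAll ends c {u, a₂}) -
        prob p (avoidAll ends a₂ {c} ∩ connEvent ends a₂ u) := by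
    rw [eU, eR, ← expect_sub]
    congr 1
    funext ω
    simp only [Pi.sub_apply]
    ring
  have e2 : expect p (fun ω => (1 - go (cluster ends ω c)) *
      (avoidAll ends c {u, a₂}).indicator 1 ω) =
      prob p (avoidAll ends c {u, a₂}) -
        prob p (clusterInEvent ends a₂ 𝓥 ∩ avoidAll ends c {u, a₂}) := by
    rw [eO, eR, ← expect_sub]
    congr 1
    funext ω
    simp only [Pi.sub_apply]
    ring
  have e3 : expect p (fun ω => (1 - gu (cluster ends ω c)) * (1 - go (cluster ends ω c)) *
      (avoidAll ends c {u, a₂}).indicator 1 ω) ≤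
      prob p (avoidAll ends c {u, a₂}) -
        prob p (avoidAll ends a₂ {c} ∩ connEvent ends a₂ u) -
        prob p (clusterInEvent ends a₂ 𝓥 ∩ avoidAll ends c {u, a₂}) +
        prob p (avoidAll ends a₂ {c} ∩ (connEvent ends a₂ u ∩ clusterInEvent ends a₂ 𝓥)) := by
    rw [eUO, eU, eO, eR, ← expect_sub, ← expect_sub, ← expect_add]
    refine expect_mono hp fun ω => ?_
    simp only [Pi.sub_apply, Pi.add_apply]
    have hind : 0 ≤ (avoidAll ends c {u, a₂}).indicator (1 : Config E → R) ω :=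
      Set.indicator_apply_nonneg fun _ => zero_le_one
    have h := mul_le_mul_of_nonneg_right (hpt (cluster ends ω c)) hind
    nlinarith [h]
  rw [e1, e2] at key
  have hR0 : 0 ≤ prob p (avoidAll ends c {u, a₂}) := prob_nonneg hp _
  have eO' : prob p (avoidAll ends c {u, a₂} ∩ clusterInEvent ends a₂ 𝓥) =
      prob p (clusterInEvent ends a₂ 𝓥 ∩ avoidAll ends c {u, a₂}) := by
    rw [Set.inter_comm]
  rw [eO']
  nlinarith [key, mul_le_mul_of_nonneg_right e3 hR0]


/-- **(SW2-𝓥)**: for every up-set `𝓥` of vertex sets,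
`P(a₂ ↮ c, a₂ ↔ u) · P(PD, K ∈ 𝓥) ≤ P(PD) · P(a₂ ↮ c, a₂ ↔ u, K ∈ 𝓥)` (`K = C(a₂)`);
`SW2.sw2` is the case `𝓥 = {W | o ∈ W}`. -/
theorem sw2_upset (hp : IsProbVec p) {𝓥 : Set (Set V)} (h𝓥 : IsUpperSet 𝓥) :
    prob p (avoidAll ends a₂ {c} ∩ connEvent ends a₂ u) *
        prob p (PDEvent ends u a₂ c ∩ clusterInEvent ends a₂ 𝓥) ≤
      prob p (PDEvent ends u a₂ c) *
        prob p (avoidAll ends a₂ {c} ∩ (connEvent ends a₂ u ∩ clusterInEvent ends a₂ 𝓥)) := by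
  have h := sw2_core_upset p ends a₂ c u hp h𝓥
  have h1 := prob_avoid_eq_PD_add p ends a₂ c u Set.univ
  have h2 := prob_avoid_eq_PD_add p ends a₂ c u (clusterInEvent ends a₂ 𝓥)
  simp only [Set.inter_univ] at h1
  rw [h1, h2] at h
  nlinarith [h]

/-- (SW2) for a pair of vertices: `P(a₂ ↮ c, a₂ ↔ u) · P(PD, x ∈ K, y ∈ K) ≤ P(PD) · P(a₂ ↮ c, a₂ ↔ u, x ∈ K, y ∈ K)`
(the pair domination of P4-G8-SEP.md §10(b)). -/
theorem sw2_pair (hp : IsProbVec p) (x y : V) :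
    prob p (avoidAll ends a₂ {c} ∩ connEvent ends a₂ u) *
        prob p (PDEvent ends u a₂ c ∩ (connEvent ends a₂ x ∩ connEvent ends a₂ y)) ≤
      prob p (PDEvent ends u a₂ c) *
        prob p (avoidAll ends a₂ {c} ∩ (connEvent ends a₂ u ∩ (connEvent ends a₂ x ∩ connEvent ends a₂ y))) := by
  have h := sw2_upset p ends a₂ c u hp (𝓥 := {W | x ∈ W} ∩ {W | y ∈ W})
    (fun _ _ hle hW => ⟨hle hW.1, hle hW.2⟩)
  have e : clusterInEvent ends a₂ ({W | x ∈ W} ∩ {W | y ∈ W}) =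
      connEvent ends a₂ x ∩ connEvent ends a₂ y := rfl
  rw [e] at h
  exact h

end Upset

end SW2

end RootLeafU

end Summit.Ventures.PercRepro2
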